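import Summits.QuantumFields.YangMills.Theorems.ParabolicTrajectoryLatticeGapOnTrajectoryTransferSymDefs
import Summits.QuantumFields.YangMills.Theorems.ParabolicTrajectoryLatticeGapOnTrajectoryStubSlabClustering
import Summits.QuantumFields.YangMills.Theorems.ParabolicTrajectoryLatticeGapOnTrajectoryStubSmoothingToGap
import Summits.QuantumFields.YangMills.Theorems.ParabolicTrajectoryLatticeGapOnTrajectoryStubKRFiniteSizeDecay
import Summits.QuantumFields.YangMills.Theorems.ParabolicTrajectoryLatticeGapOnTrajectoryStubTorusFrames
import Summits.QuantumFields.YangMills.Theorems.ParabolicTrajectoryLatticeGapOnTrajectoryStubSpecificationTower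
import Summits.QuantumFields.YangMills.Theorems.ParabolicTrajectoryLatticeGapOnTrajectoryStubWilsonTorusDLR
import HarnessLib

/-!
# Crux `LatticeGapOnTrajectory` (stmt-QuantumFields-10523): the TYPED DECOMPOSITION of the filed crux
# into its lattice physics and the two transfer residuals (definitions + landed glue; lead c3, 2026-08-16)

Six line leads (-0, -c1, -a1, -a2, -c2, -c3) and the drefuter concur: conjunct (B) of route
`ParabolicTrajectory` AS FILED is the conjunction of an open lattice statement and a transfer clause
that no line can derive, for two independent, typed reasons — (α) the clause quantifies over ALL witness
renormalisations `sch'`, (β) the hypotheses carry no physical-volume clause. The registered skeleton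
`Cruxes/LatticeGapOnTrajectory/Lines/line_orbit_kantorovich_finite_size.lean` (reshape 4c) isolates them
as the residual stubs `stub_symmetrise` / `stub_volume`. This file turns that isolation into IMPORTABLE
declarations, so that a planner's `route edit --split` or `--restate` acts on landed names:

* `Split.LatticeGapOnTrajectoryLat` — Sub₁, the PHYSICS, pure lattice: the crux hypotheses imply
  `∃ Δ > 0, HasLatticeMassGap r sch Δ ∧ UniformSlabClustering r sch Δ` (the summit's lattice clause and
  the cluster-expansion-format slab clustering every sup-norm IR engine outputs); no transfer clause,
  no witness scheme, no volume clause.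
* `Split.VolumeGrowthOnTrajectory` — Sub₂ = residual (β): the crux hypotheses imply
  `sch.HasVolumeGrowth` (`a_k L_k / log(a_k⁻¹) → ∞`). NOT claimed provable (the hypotheses mention `L_k`
  only through `a_k L_k → ∞`); it is the clause the restatement ADDS to (B) and lets (S) output.
* `Split.SymmetrisationOnTrajectory` — Sub₃ = residual (α): along the crux hypotheses, the transfer
  clause for reflection-symmetric polynomially bounded witnesses (`TransferHalfSym`) implies the filed
  clause over all `sch'` (`TransferHalf`) at some rate. NOT claimed provable (Müntz obstruction,
  `Theorems/LatticeGapOnTrajectory/Negative/TransferObstruction.lean`); it is the clause the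
  restatement DELETES from (B) and lets (A) output.
* `Split.latticeGapOnTrajectory_of_subs : Sub₁ → Sub₂ → Sub₃ → LatticeGapOnTrajectory` — the glue,
  sorry-free, through the landed bridge `Transfer.transferHalfSym_of_uniformSlabClustering` (p123282).
* `Split.OrbitKRWindowsAlongP` + `Split.latticeGapOnTrajectoryLat_of_windowsP` — Sub₁ is EXACTLY what
  the line's one open physics stub delivers (`stub_orbitKantorovichWindow`, P-version), through the
  landed smoothing (p95642) and slab-clustering (p123095) stubs fed with the landed engine package.
* `Split.LatticeGapOnTrajectoryRV` (the repaired (B), text of `Cruxes/…/RestatementC2.lean`) with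
  `Split.latticeGapOnTrajectoryRV_of_lat : Sub₁ → RV` and `Split.latticeGapOnTrajectoryRV_of_filed :
  LatticeGapOnTrajectory → RV` — the 1:1 restatement option: RV is weaker than the filed (B) and is
  closed by this line modulo its physics stub alone.

References: Osterwalder–Seiler 1978 §2; Glimm–Jaffe 1987 §6.1, §19.7; Dobrushin–Shlosman 1985.
-/

open scoped ComplexConjugate Topology
open Filter MeasureTheory
open Literature.MathematicalPhysics.QuantumLattice Literature.MathematicalPhysics.QuantumFieldTheory
open Summit.QuantumFields.YangMills.Theses.ParabolicTrajectory

noncomputable section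

namespace Summit.QuantumFields.YangMills.Cruxes.LatticeGapOnTrajectory.OrbitKantorovichFiniteSize

namespace Split

/-! ## §1 The three sub-statements -/

/-- **Sub₁ — the lattice physics of (B), pure lattice (`LatticeGapOnTrajectoryLat`).** For every compact
simple `G`, lattice representation `r`, `M ≥ 2`, `θ > 0` and every `M`-adic Wilson scheme with
`β_k → ∞` tuned by `a_k⁻⁸⟨P; τ_{1/a_k}P⟩ → θ`, there is `Δ > 0` with the summit's per-pair sup-norm
lattice gap `HasLatticeMassGap r sch Δ` AND uniform slab clustering at rate `Δ` in cluster-expansion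
format on the scheme's own tori (`Transfer.UniformSlabClustering r sch Δ`). No transfer clause, no
witness renormalisation, no volume clause: this is the open infrared content of the crux (weak-coupling
mass gap of four-dimensional lattice Yang–Mills along a tuned trajectory). A sub-statement of OUR crux
(obligation piece, not a published fact; deliberately untagged so that the gate does not relocate it). -/
def LatticeGapOnTrajectoryLat : Prop :=
  ∀ (G : Type) [Group G] [TopologicalSpace G] [IsTopologicalGroup G] [CompactSpace G]
    [MeasurableSpace G] [BorelSpace G], IsCompactSimpleLieGroup G →
    ∀ (r : LatticeRep G) (M : ℕ) (θ : ℝ) (sch : SpeciesScheme (YMSpecies G)) (n : ℕ → ℕ),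
      2 ≤ M → 0 < θ → (∀ k, sch.a k = ((M : ℝ) ^ n k)⁻¹) → Tendsto sch.β atTop atTop →
      Tendsto (fun k => ((M : ℝ) ^ n k) ^ 8 *
          latticeConnectedCorr r.ρ (sch.β k) (sch.side k) r.curvature.F r.curvature.F (M ^ n k))
        atTop (𝓝 θ) →
      ∃ Δ : ℝ, 0 < Δ ∧ HasLatticeMassGap r sch Δ ∧ Transfer.UniformSlabClustering r sch Δ

/-- **Sub₂ — residual (β), the volume clause (`VolumeGrowthOnTrajectory`).** Along the crux hypotheses
the physical time extent of the scheme's torus outgrows the logarithm of the cutoff,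
`sch.HasVolumeGrowth` (`a_k L_k / log(a_k⁻¹) → ∞`). This is NOT claimed provable — the hypotheses see
`L_k` only through `SpeciesScheme.tendsto_L : a_k L_k → ∞` — it is the typed form of the clause the
restatement adds to (B) (and lets (S) output, free for the tuner). A sub-statement of OUR crux (obligation
piece, not a published fact; deliberately untagged). -/
def VolumeGrowthOnTrajectory : Prop :=
  ∀ (G : Type) [Group G] [TopologicalSpace G] [IsTopologicalGroup G] [CompactSpace G]
    [MeasurableSpace G] [BorelSpace G], IsCompactSimpleLieGroup G →
    ∀ (r : LatticeRep G) (M : ℕ) (θ : ℝ) (sch : SpeciesScheme (YMSpecies G)) (n : ℕ → ℕ),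
      2 ≤ M → 0 < θ → (∀ k, sch.a k = ((M : ℝ) ^ n k)⁻¹) → Tendsto sch.β atTop atTop →
      Tendsto (fun k => ((M : ℝ) ^ n k) ^ 8 *
          latticeConnectedCorr r.ρ (sch.β k) (sch.side k) r.curvature.F r.curvature.F (M ^ n k))
        atTop (𝓝 θ) →
      sch.HasVolumeGrowth

/-- **Sub₃ — residual (α), symmetrisation of the transfer clause (`SymmetrisationOnTrajectory`).**
Along the crux hypotheses, the transfer clause for reflection-SYMMETRIC polynomially bounded witness
renormalisations at any rate `Δ > 0` (`Transfer.TransferHalfSym r sch Δ`) implies the filed clause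
over ALL witness schemes `sch'` at some rate (`TransferHalf r sch Δ'`). NOT claimed provable: the
`T`-diagonal pair of a species is the lattice off-diagonal OS pair `(sΘ, s)`, whose Cauchy–Schwarz
constant carries the unconstrained witness ratio `c_s/c_{sΘ}`; pointwise limits of gapped signed
Laplace transforms keep no rate (`Negative/TransferObstruction.lean`). It is the typed form of the
restriction the restatement imposes on (B)'s `∀ sch'` (and lets (A) output). A sub-statement of OUR crux
(obligation piece, not a published fact; deliberately untagged). -/
def SymmetrisationOnTrajectory : Prop :=
  ∀ (G : Type) [Group G] [TopologicalSpace G] [IsTopologicalGroup G] [CompactSpace G]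
    [MeasurableSpace G] [BorelSpace G], IsCompactSimpleLieGroup G →
    ∀ (r : LatticeRep G) (M : ℕ) (θ : ℝ) (sch : SpeciesScheme (YMSpecies G)) (n : ℕ → ℕ),
      2 ≤ M → 0 < θ → (∀ k, sch.a k = ((M : ℝ) ^ n k)⁻¹) → Tendsto sch.β atTop atTop →
      Tendsto (fun k => ((M : ℝ) ^ n k) ^ 8 *
          latticeConnectedCorr r.ρ (sch.β k) (sch.side k) r.curvature.F r.curvature.F (M ^ n k))
        atTop (𝓝 θ) →
      ∀ Δ : ℝ, 0 < Δ → Transfer.TransferHalfSym r sch Δ → ∃ Δ' : ℝ, 0 < Δ' ∧ TransferHalf r sch Δ'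

/-! ## §2 Monotonicity in the rate -/

section Anti

variable {G : Type} [Group G] [TopologicalSpace G] [IsTopologicalGroup G] [CompactSpace G]
  [MeasurableSpace G] [BorelSpace G]

/-- The per-pair lattice gap is antitone in the rate. [folklore] -/
theorem hasLatticeMassGap_of_le {ι : Type} (r : LatticeRep G) (sch : SpeciesScheme ι) {Δ Δ' : ℝ}
    (hΔ' : Δ' ≤ Δ) (h : HasLatticeMassGap r sch Δ) : HasLatticeMassGap r sch Δ' := by
  intro A B
  obtain ⟨C, hC⟩ := h A B
  refine ⟨max C 0, hC.mono fun k hk S hS n hn => (hk S hS n hn).trans ?_⟩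
  have hx : 0 ≤ sch.a k * n := mul_nonneg (sch.a_pos k).le (Nat.cast_nonneg n)
  calc C * Real.exp (-(Δ * (sch.a k * n)))
      ≤ max C 0 * Real.exp (-(Δ * (sch.a k * n))) :=
        mul_le_mul_of_nonneg_right (le_max_left _ _) (Real.exp_pos _).le
    _ ≤ max C 0 * Real.exp (-(Δ' * (sch.a k * n))) :=
        mul_le_mul_of_nonneg_left (Real.exp_le_exp.2 (by nlinarith)) (le_max_right _ _)

/-- Uniform slab clustering is antitone in the rate. [folklore] -/
theorem uniformSlabClustering_of_le (r : LatticeRep G) (sch : SpeciesScheme (YMSpecies G)) {Δ Δ' : ℝ}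
    (hΔ' : Δ' ≤ Δ) (h : Transfer.UniformSlabClustering r sch Δ) :
    Transfer.UniformSlabClustering r sch Δ' := by
  obtain ⟨p, K, hK, hev⟩ := h
  refine ⟨p, K, hK, hev.mono fun k hk w N X B hX hB hdep hN => (hk w N X B hX hB hdep hN).trans ?_⟩
  have hx : 0 ≤ sch.a k * N := mul_nonneg (sch.a_pos k).le (Nat.cast_nonneg N)
  have h0 : 0 ≤ K * ((sch.a k)⁻¹ * ((w : ℝ) + 1) * ((sch.L k : ℝ) + 1)) ^ p * B ^ 2 := by
    have ha : 0 ≤ (sch.a k)⁻¹ := inv_nonneg.2 (sch.a_pos k).le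
    positivity
  refine mul_le_mul_of_nonneg_left (Real.exp_le_exp.2 ?_) h0
  have : Δ' * (sch.a k * N) ≤ Δ * (sch.a k * N) := mul_le_mul_of_nonneg_right hΔ' hx
  calc -Δ * sch.a k * ↑N = -(Δ * (sch.a k * N)) := by ring
    _ ≤ -(Δ' * (sch.a k * N)) := neg_le_neg this
    _ = -Δ' * sch.a k * ↑N := by ring

end Anti

/-! ## §3 The glue: Sub₁ → Sub₂ → Sub₃ → the filed crux -/

/-- **The decomposition closes the filed crux** (`LatticeGapOnTrajectory` BY NAME): Sub₁ gives
`Δ₁ > 0` with the lattice gap and uniform slab clustering; Sub₂ gives the volume clause; the landed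
bridge `Transfer.transferHalfSym_of_uniformSlabClustering` (Hankel log-convexity + site reflection
positivity of the odd Wilson tori, p123282/p121787/p120012) gives the symmetric transfer clause at rate
`Δ₁`; Sub₃ turns it into the filed clause at some `Δ' > 0`; both halves are antitone, so `Δ = min Δ₁ Δ'`.
[cite: OsterwalderSeiler1978, §2] [cite: GlimmJaffe1987, §19.7] -/
theorem latticeGapOnTrajectory_of_subs (h₁ : LatticeGapOnTrajectoryLat) (h₂ : VolumeGrowthOnTrajectory)
    (h₃ : SymmetrisationOnTrajectory) : LatticeGapOnTrajectory := by
  intro G _ _ _ _ hG r M θ sch n hM hθ hshape hβ htune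
  letI : MeasurableSpace G := borel G
  haveI : BorelSpace G := ⟨rfl⟩
  obtain ⟨Δ₁, hΔ₁, hlat, hclust⟩ := h₁ G hG r M θ sch n hM hθ hshape hβ htune
  have hvol : sch.HasVolumeGrowth := h₂ G hG r M θ sch n hM hθ hshape hβ htune
  have hsym : Transfer.TransferHalfSym r sch Δ₁ :=
    Transfer.transferHalfSym_of_uniformSlabClustering r sch hM hshape hβ hvol hclust
  obtain ⟨Δ', hΔ', htr⟩ := h₃ G hG r M θ sch n hM hθ hshape hβ htune Δ₁ hΔ₁ hsym
  exact ⟨min Δ₁ Δ', lt_min hΔ₁ hΔ', hasLatticeMassGap_of_le r sch (min_le_left _ _) hlat,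
    transferHalf_anti G r sch Δ' (min Δ₁ Δ') (min_le_right _ _) htr⟩

/-! ## §4 Sub₁ is what the line's physics stub delivers -/

section Windows

variable {G : Type} [Group G] [TopologicalSpace G] [IsTopologicalGroup G] [CompactSpace G]
  [MeasurableSpace G] [BorelSpace G]

/-- **Orbit–Kantorovich windows along the scheme, P-version** (verbatim the conclusion of the
registered physics stub `stub_orbitKantorovichWindow`, reshape 4b/4c): `OrbitKRWindowsAlong r M sch n`
with, on the SAME resolution `α`, the clause `∃ p₀ K₀, ∀ᶠ k, |β_k| α_k ≤ K₀ a_k^{-p₀}` that makes the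
total-variation Lipschitz constant of Wilson's slab kernels polynomial in the cutoff. [folklore] -/
def OrbitKRWindowsAlongP (r : LatticeRep G) (M : ℕ) (sch : SpeciesScheme (YMSpecies G)) (n : ℕ → ℕ) :
    Prop :=
  ∃ (t n₀ : ℕ) (γ₀ : ℝ) (α : ℕ → ℝ) (K : ℕ → ℝ), 1 ≤ t ∧ 0 ≤ γ₀ ∧ γ₀ < 1 ∧ (∀ k, 0 < α k) ∧
    (∃ (p₀ : ℕ) (K₀ : ℝ), ∀ᶠ k in atTop, |sch.β k| * α k ≤ K₀ * ((sch.a k)⁻¹) ^ p₀) ∧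
    ∀ s : ℕ, ∀ᶠ k in atTop, ∀ S : ℕ, sch.L k ≤ S →
      ∀ (μ : Fin 4 → ℕ) (q : (i : Fin 4) → ZMod (2 * S + 1) → ZMod (μ i + 1)),
        (∀ i, 2 * n₀ + 3 ≤ μ i + 1) → (∀ i, IsTorusFrame (2 * S + 1) (t * M ^ n k) (q i)) →
          (∃ kp : CoarseIdx μ → CoarseIdx μ → CoarseIdx μ → ℝ,
              IsKRWindow (cellOf q) (orbitWeight r (α k) q) (torusYM r.ρ (sch.β k) (2 * S + 1)) 1 n₀ γ₀ kp) ∧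
          RoughCentreBound r (sch.β k) (2 * S + 1) q (α k) n₀ s (K s)

/-- Dropping the polynomial clause gives the plain window package. [folklore] -/
theorem orbitKRWindowsAlong_of_P {r : LatticeRep G} {M : ℕ} {sch : SpeciesScheme (YMSpecies G)}
    {n : ℕ → ℕ} (h : OrbitKRWindowsAlongP r M sch n) : OrbitKRWindowsAlong r M sch n := by
  obtain ⟨t, n₀, γ₀, α, K, ht, hγ₀, hγ₁, hα, -, hrest⟩ := h
  exact ⟨t, n₀, γ₀, α, K, ht, hγ₀, hγ₁, hα, hrest⟩

/-- **From the windows to Sub₁'s conclusion, one scheme**: the landed smoothing stub gives the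
per-pair lattice gap at some `Δ₁ > 0`, the landed slab-clustering stub gives uniform slab clustering at
some `Δ₂ > 0` (both fed with the landed KR engine, torus frames, specification tower and Wilson torus
DLR description); both are antitone, so `Δ = min Δ₁ Δ₂` serves both. [cite: Follmer1988, Ch. I Theorem (2.13)] -/
theorem gap_and_slabClustering_of_windowsP (r : LatticeRep G) {M : ℕ} (sch : SpeciesScheme (YMSpecies G))
    {n : ℕ → ℕ} (hM : 2 ≤ M) (hshape : ∀ k, sch.a k = ((M : ℝ) ^ n k)⁻¹)
    (hW : OrbitKRWindowsAlongP r M sch n) :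
    ∃ Δ : ℝ, 0 < Δ ∧ HasLatticeMassGap r sch Δ ∧ Transfer.UniformSlabClustering r sch Δ := by
  obtain ⟨Δ₁, hΔ₁, hlat⟩ :=
    stub_smoothingToGap G r M sch n hM hshape stub_krFiniteSizeDecay stub_torusFrames stub_specificationTower
      (stub_wilsonTorusDLR G r) (orbitKRWindowsAlong_of_P hW)
  obtain ⟨Δ₂, hΔ₂, hclust⟩ :=
    stub_slabClustering G r M sch n hM hshape stub_krFiniteSizeDecay stub_torusFrames stub_specificationTower
      (stub_wilsonTorusDLR G r) hW
  exact ⟨min Δ₁ Δ₂, lt_min hΔ₁ hΔ₂, hasLatticeMassGap_of_le r sch (min_le_left _ _) hlat,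
    uniformSlabClustering_of_le r sch (min_le_right _ _) hclust⟩

end Windows

/-- **Sub₁ ⇐ the physics stub**: if the orbit–Kantorovich windows (P-version) hold along every tuned
`M`-adic weak-coupling Wilson scheme of every compact simple `G` — the statement of the registered stub
`stub_orbitKantorovichWindow` — then Sub₁ holds. Hence, under the restatement, line
`orbit-kantorovich-finite-size` is closed modulo its physics stub alone. [cite: Follmer1988, Ch. I Theorem (2.13)] -/
theorem latticeGapOnTrajectoryLat_of_windowsP
    (hW : ∀ (G : Type) [Group G] [TopologicalSpace G] [IsTopologicalGroup G] [CompactSpace G]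
      [MeasurableSpace G] [BorelSpace G], IsCompactSimpleLieGroup G →
      ∀ (r : LatticeRep G) (M : ℕ) (θ : ℝ) (sch : SpeciesScheme (YMSpecies G)) (n : ℕ → ℕ),
        2 ≤ M → 0 < θ → (∀ k, sch.a k = ((M : ℝ) ^ n k)⁻¹) → Tendsto sch.β atTop atTop →
        Tendsto (fun k => ((M : ℝ) ^ n k) ^ 8 *
            latticeConnectedCorr r.ρ (sch.β k) (sch.side k) r.curvature.F r.curvature.F (M ^ n k))
          atTop (𝓝 θ) → OrbitKRWindowsAlongP r M sch n) :
    LatticeGapOnTrajectoryLat :=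
  fun G _ _ _ _ _ _ hG r M θ sch n hM hθ hshape hβ htune =>
    gap_and_slabClustering_of_windowsP r sch hM hshape (hW G hG r M θ sch n hM hθ hshape hβ htune)

/-! ## §5 The 1:1 restatement option: the repaired (B) -/

/-- **(B) repaired, both defects removed (`LatticeGapOnTrajectoryRV`; text of
`Cruxes/LatticeGapOnTrajectory/RestatementC2.lean`).** Verbatim the filed `LatticeGapOnTrajectory`
except: (β) the extra hypothesis `a_k L_k / log(a_k⁻¹) → ∞`, and (α) the transfer clause quantifies over
witness schemes `sch'` with the same `(a, β, L)` whose renormalisations are time-reflection symmetric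
and polynomially bounded in the cutoff. A restatement of OUR crux for the planner (obligation text, not a
published fact; deliberately untagged). -/
def LatticeGapOnTrajectoryRV : Prop :=
  ∀ (G : Type) [Group G] [TopologicalSpace G] [IsTopologicalGroup G] [CompactSpace G],
    IsCompactSimpleLieGroup G → letI : MeasurableSpace G := borel G; haveI : BorelSpace G := ⟨rfl⟩;
    ∀ (r : LatticeRep G) (M : ℕ) (θ : ℝ) (sch : SpeciesScheme (YMSpecies G)) (n : ℕ → ℕ),
    2 ≤ M → 0 < θ → (∀ k, sch.a k = ((M : ℝ) ^ n k)⁻¹) → Filter.Tendsto sch.β Filter.atTop Filter.atTop →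
    Filter.Tendsto (fun k => sch.a k * sch.L k / Real.log (sch.a k)⁻¹) Filter.atTop Filter.atTop →
    Filter.Tendsto (fun k => ((M : ℝ) ^ n k) ^ 8 *
      latticeConnectedCorr r.ρ (sch.β k) (sch.side k) r.curvature.F r.curvature.F (M ^ n k))
      Filter.atTop (nhds θ) →
    ∃ Δ : ℝ, 0 < Δ ∧ HasLatticeMassGap r sch Δ ∧
      ∀ sch' : SpeciesScheme (YMSpecies G), sch'.a = sch.a → sch'.β = sch.β → sch'.L = sch.L →
        sch'.IsReflectionSymmetric →
        (∀ s, ∃ (q : ℕ) (K : ℝ), ∀ k,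
          |sch'.c s k| ≤ K * ((sch'.a k)⁻¹) ^ q ∧ |sch'.m s k| ≤ K * ((sch'.a k)⁻¹) ^ q) →
        ∀ T : OSData (YMSpecies G) 4, IsYangMillsFor r sch' T → T.HasMassGap Δ

/-- **Sub₁ alone closes the repaired (B)**: the volume clause is now a hypothesis and the symmetric
transfer is the landed bridge — SAME rate `Δ`. [cite: GlimmJaffe1987, §19.7] -/
theorem latticeGapOnTrajectoryRV_of_lat (h : LatticeGapOnTrajectoryLat) : LatticeGapOnTrajectoryRV := by
  intro G _ _ _ _ hG r M θ sch n hM hθ hshape hβ hvol htune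
  letI : MeasurableSpace G := borel G
  haveI : BorelSpace G := ⟨rfl⟩
  obtain ⟨Δ, hΔ, hlat, hclust⟩ := h G hG r M θ sch n hM hθ hshape hβ htune
  exact ⟨Δ, hΔ, hlat, fun sch' ha hb hL hsym hpoly T hT =>
    Transfer.transferHalfSym_of_uniformSlabClustering r sch hM hshape hβ hvol hclust sch' ha hb hL hsym hpoly T hT⟩

/-- The repaired (B) is WEAKER than (B) as filed (a hypothesis added, the `∀ sch'` clause restricted):
nothing proved toward the filed item is lost by the restatement. [folklore] -/
theorem latticeGapOnTrajectoryRV_of_filed (h : LatticeGapOnTrajectory) : LatticeGapOnTrajectoryRV := by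
  intro G _ _ _ _ hG r M θ sch n hM hθ hshape hβ _ htune
  obtain ⟨Δ, hΔ, hgap, htr⟩ := h G hG r M θ sch n hM hθ hshape hβ htune
  exact ⟨Δ, hΔ, hgap, fun sch' ha hb hL _ _ T hT => htr sch' ha hb hL T hT⟩

end Split

end Summit.QuantumFields.YangMills.Cruxes.LatticeGapOnTrajectory.OrbitKantorovichFiniteSize

end
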